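import Literature.AlgebraicGeometry.Frobenioids.ArchimedeanFSMMono
import Literature.AlgebraicGeometry.Frobenioids.ArchimedeanFSMLifting
import Literature.AlgebraicGeometry.Frobenioids.ArchimedeanSlitTools
import HarnessLib

/-!
# Frobenioids II, Proposition 3.4 (iii) REPAIRED: the complex regime
# (abc-iut cell, layer L1, node `FrdII:Prop3.4(iii)R`, chain LC-L1-2)

Mochizuki, *The geometry of Frobenioids II: poly-Frobenioids*, Kyushu J. Math. **62** (2008)
401–460, §3, Proposition 3.4 (iii), (vi) p. 30. [cite: MochizukiFrdII2008, Prop 3.4 (iii) p.30]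

Item (iii) as typed (`ArchFrd.Prop34_iii π`, "FSM-morphisms of `F` project to FSM-morphisms of
`D`") is FALSE at `π = 𝟭 D₀` (`ArchFrd.not_prop34_iii_id`, file `ArchimedeanFSMCounterexample`):
the obstruction is an arrow of `D` into an object lying over the REAL object of `D₀`, which
coequalizes the two Galois twists. PROVED here (proof-only, nothing defined; ruling L1-lead
2026-08-25T21:23:20Z (2), candidate (R-a)): in the **complex regime** — every object of `D` lies
over `Spec ℂ`, as is the case for the archimedean places of a number field containing `√−1`
([IUTchI] §3) — item (iii) HOLDS for `F = A, N, R` (`prop34_iii_of_isComplex`), because then every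
arrow of `F` satisfies condition (a) of item (ii) (its projection to `D₀` is an automorphism of
`Spec ℂ`, `D0.isIso_of_isComplex` of seat abc-iut-L1-t6's `ArchimedeanSlitTools`), so item (ii) holds outright (`prop34_ii_of_isComplex`) and
(iii) follows from (i) (`prop34_i_holds`) and the condition-(a) half of (ii) (`prop34_ii_condA`);
consequently the full bundled item (vi) (`Prop34_vi π`, whose FSMI clause cites (iii)) HOLDS in
the complex regime (`prop34_vi_of_isComplex`). No side is taken on [IUTchIII] Cor. 3.12.
-/

namespace Literature.AlgebraicGeometry.Frobenioids

open CategoryTheory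

namespace ArchFrd

universe v u

variable {D : Type u} [Category.{v} D] (π : D ⥤ D0)

/-- In the complex regime every arrow of a tower `F ∈ {A, N, R}` satisfies condition (a) of
Prop. 3.4 (ii): it projects to an isomorphism of `D₀`. [cite: MochizukiFrdII2008, Prop 3.4 (ii) p.30] -/
theorem Tower.condA_of_isComplex (T : Tower π) (hD : ∀ d : D, (π.obj d).IsComplex) {X Y : T.F}
    (φ : X ⟶ Y) : T.CondA φ :=
  D0.isIso_of_isComplex _ (hD _) (hD _)

/-- **Proposition 3.4 (ii) (complex regime)**: if every object of `D` lies over `Spec ℂ`, then for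
`F = A, N, R` every monomorphism of `F` projects to a monomorphism of `D` (condition (a) always
holds). [cite: MochizukiFrdII2008, Prop 3.4 (ii) p.30] -/
theorem prop34_ii_of_isComplex (hD : ∀ d : D, (π.obj d).IsComplex) : Prop34_ii π := by
  obtain ⟨mA, mN, mR⟩ := prop34_ii_condA π
  exact ⟨fun X Y φ hφ _ => mA φ hφ ((towerA π).condA_of_isComplex π hD φ),
    fun X Y φ hφ _ => mN φ hφ ((towerN π).condA_of_isComplex π hD φ),
    fun X Y φ hφ _ => mR φ hφ ((towerR π).condA_of_isComplex π hD φ)⟩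

/-- **Proposition 3.4 (iii), REPAIRED (complex regime)**: if every object of `D` lies over
`Spec ℂ`, then for `F = A, N, R` "FSM-morphisms of `F` project to FSM-morphisms of `D`" — from (i)
and the condition-(a) half of (ii). [cite: MochizukiFrdII2008, Prop 3.4 (iii) p.30] -/
theorem prop34_iii_of_isComplex (hD : ∀ d : D, (π.obj d).IsComplex) : Prop34_iii π := by
  obtain ⟨hA, hN, hR⟩ := prop34_i_holds π
  obtain ⟨mA, mN, mR⟩ := prop34_ii_condA π
  exact ⟨fun X Y φ hφ => ⟨hA φ hφ.1, mA φ hφ.2 ((towerA π).condA_of_isComplex π hD φ)⟩,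
    fun X Y φ hφ => ⟨hN φ hφ.1, mN φ hφ.2 ((towerN π).condA_of_isComplex π hD φ)⟩,
    fun X Y φ hφ => ⟨hR φ hφ.1, mR φ hφ.2 ((towerR π).condA_of_isComplex π hD φ)⟩⟩

/-- **Proposition 3.4 (vi) in full (complex regime)**: main clause, irreducible clause and FSMI
clause for `F = A, N, R`, the FSMI clause through the repaired (iii).
[cite: MochizukiFrdII2008, Prop 3.4 (vi) p.30] -/
theorem prop34_vi_of_isComplex (hD : ∀ d : D, (π.obj d).IsComplex) : Prop34_vi π :=
  prop34_vi_of_prop34_iii π (prop34_iii_of_isComplex π hD)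

end ArchFrd

end Literature.AlgebraicGeometry.Frobenioids
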